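import Mathlib
import Summits.Ventures.PercRepro2.CoinChainXAClosedGateGen
import Summits.Ventures.PercRepro2.CoinChainXAGateHull

/-!
# (XA′) on the segment from the closed gate to any gate open on the sure-entered clusters
(blind cell PercRepro2, night-2 g30)

With the closed gate a theorem for every entry structure and every pair of markers
(`chain_XA'_closed_gate_gen`), the affinity of (XA′) in the gate (`chain_XA'_of_gate_mix3`) gives
(XA′) for every gate `d' = θ·d₁` with `0 ≤ θ ≤ 1` and `d₁` an admissible gate equal to `d` on the
sure-entered clusters (there `Cross = 0` and (XA′) is the mixed-centre theorem,
`chain_XA'_of_gate_on_De`) — in particular for every proportional gate `d' = θ·d`.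
-/

namespace Summit.Ventures.PercRepro2.Coin

open Classical

section ClosedGateHull

variable {V : Type*} [DecidableEq V] {R : Type*} [Field R] [LinearOrder R] [IsStrictOrderedRing R]

/-- **(XA′) ON THE SEGMENT FROM THE CLOSED GATE TO A GATE OPEN ON THE SURE-ENTERED CLUSTERS**:
`d' = θ·d₁`, `0 ≤ θ ≤ 1`, `d₁` admissible with `d₁ = d` on the clusters meeting `ent`; every entry
structure, every pair of nonnegative increasing markers `≤ 1`, positive ideal mass. -/
theorem chain_XA'_of_scaled_gate_on_De (U ent ent' : Finset V) (ν c d d₁ d' : Finset V → R)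
    (hν0 : ∀ W, 0 ≤ ν W) (hν : ∀ s ⊆ U, ∀ t ⊆ U, ν s * ν t ≤ ν (s ∩ t) * ν (s ∪ t))
    (hc0 : ∀ W, 0 ≤ c W) (hd0 : ∀ W, 0 ≤ d W) (hd₁0 : ∀ W, 0 ≤ d₁ W)
    (hdc : ∀ W, d W ≤ c W) (hd₁c : ∀ W, d₁ W ≤ c W)
    (hcc : ∀ s t, c s * c t ≤ c (s ∩ t) * c (s ∪ t))
    (hdd : ∀ s t, d s * d t ≤ d (s ∩ t) * d (s ∪ t))
    (hd₁d₁ : ∀ s t, d₁ s * d₁ t ≤ d₁ (s ∩ t) * d₁ (s ∪ t))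
    (hcd : ∀ s t, c s * d t ≤ c (s ∩ t) * d (s ∪ t))
    (hcd₁ : ∀ s t, c s * d₁ t ≤ c (s ∩ t) * d₁ (s ∪ t))
    (hdd₁ : ∀ s t, d s * d₁ t ≤ d (s ∩ t) * d₁ (s ∪ t))
    (hratio : ∀ s t, s ⊆ t → d s * c t ≤ c s * d t)
    (hratio₁ : ∀ s t, s ⊆ t → d₁ s * c t ≤ c s * d₁ t)
    (hd₁ : ∀ W, (∃ r ∈ ent, r ∈ W) → d₁ W = d W)
    (θ : R) (hθ0 : 0 ≤ θ) (hθ1 : θ ≤ 1) (hd' : ∀ W, d' W = θ * d₁ W)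
    (x y : Finset V → R) (hx0 : ∀ W, 0 ≤ x W) (hy0 : ∀ W, 0 ≤ y W) (hx1 : ∀ W, x W ≤ 1)
    (hxm : ∀ s t, x s ≤ x (s ∪ t)) (hym : ∀ s t, y s ≤ y (s ∪ t))
    (hmI : 0 < ∑ W ∈ U.powerset.filter (fun W => ¬ ∃ r ∈ ent ∪ ent', r ∈ W), ν W * c W) :
    (((∑ W ∈ U.powerset, ν W * chainMix ent ent' 0 c d W) * (∑ W ∈ U.powerset, ν W * chainMix ent ent' 1 c d W * x W) - (∑ W ∈ U.powerset, ν W * chainMix ent ent' 0 c d W * x W) * (∑ W ∈ U.powerset, ν W * chainMix ent ent' 1 c d W)) *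
          ((∑ W ∈ U.powerset, ν W * chainMix ent ent' 0 c d W) * (∑ W ∈ U.powerset, ν W * chainMix ent ent' 0 c d' W * y W) - (∑ W ∈ U.powerset, ν W * chainMix ent ent' 0 c d W * y W) * (∑ W ∈ U.powerset, ν W * chainMix ent ent' 0 c d' W))
        + ((∑ W ∈ U.powerset, ν W * chainMix ent ent' 0 c d W) * (∑ W ∈ U.powerset, ν W * chainMix ent ent' 1 c d W * y W) - (∑ W ∈ U.powerset, ν W * chainMix ent ent' 0 c d W * y W) * (∑ W ∈ U.powerset, ν W * chainMix ent ent' 1 c d W)) *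
          ((∑ W ∈ U.powerset, ν W * chainMix ent ent' 0 c d W) * (∑ W ∈ U.powerset, ν W * chainMix ent ent' 0 c d' W * x W) - (∑ W ∈ U.powerset, ν W * chainMix ent ent' 0 c d W * x W) * (∑ W ∈ U.powerset, ν W * chainMix ent ent' 0 c d' W))) ≤
        (∑ W ∈ U.powerset, ν W * chainMix ent ent' 0 c d W) * ((∑ W ∈ U.powerset, ν W * chainMix ent ent' 0 c d W) * (∑ W ∈ U.powerset, ν W * chainMix ent ent' 0 c d W) * (∑ W ∈ U.powerset, ν W * chainMix ent ent' 1 c d' W * (x W * y W))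
          - (∑ W ∈ U.powerset, ν W * chainMix ent ent' 0 c d W) * (∑ W ∈ U.powerset, ν W * chainMix ent ent' 0 c d W * y W) * (∑ W ∈ U.powerset, ν W * chainMix ent ent' 1 c d' W * x W)
          - (∑ W ∈ U.powerset, ν W * chainMix ent ent' 0 c d W) * (∑ W ∈ U.powerset, ν W * chainMix ent ent' 0 c d W * x W) * (∑ W ∈ U.powerset, ν W * chainMix ent ent' 1 c d' W * y W)
          + (∑ W ∈ U.powerset, ν W * chainMix ent ent' 0 c d W * x W) * (∑ W ∈ U.powerset, ν W * chainMix ent ent' 0 c d W * y W) * (∑ W ∈ U.powerset, ν W * chainMix ent ent' 1 c d' W)) := by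
  have ha0 : 0 ≤ ∑ W ∈ U.powerset, ν W * chainMix ent ent' 0 c d W :=
    Finset.sum_nonneg (fun W _ => mul_nonneg (hν0 W) (chainMix_nonneg _ _ le_rfl zero_le_one hc0 hd0 W))
  have h₁ := chain_XA'_of_gate_on_De U ent ent' ν c d d₁ hd₁ ha0 x y
    (chain_world1_mixed_nonneg U ent ent' ν c d d₁ 0 0 le_rfl zero_le_one le_rfl zero_le_one
      hν0 hν hc0 hd0 hd₁0 hdc hd₁c hcc hdd hd₁d₁ hcd hcd₁ hdd₁ hratio hratio₁ x y hx0 hy0 hxm hym)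
  exact chain_XA'_of_gate_mix3 U ent ent' ν c d d₁ d₁ d₁ d' θ 0 0 hθ0 le_rfl le_rfl (by linarith)
    (fun W => by rw [hd' W]; ring) x y h₁ h₁ h₁
    (chain_XA'_closed_gate_gen U ent ent' ν c d hν0 hν hc0 hd0 hdc hcc hcd hratio x y hx0 hy0 hx1 hxm hym hmI)

end ClosedGateHull

end Summit.Ventures.PercRepro2.Coin
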